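import Literature.InformationTheory.Coding.BrouwerZimmermannBound
import Literature.InformationTheory.QuantumCodes.CSS
import Literature.InformationTheory.QuantumCodes.OrbitReduction
import HarnessLib

/-!
# Brouwer–Zimmermann distance certificates for CSS codes: the propositional layer of methods `bz` / `bz_aut`
# (plan/CERT-FORMAT.md v1.1 §4 L5/L6, §5.3/§5.5; census/search-1/BZ-CHECKER-SPEC.md §L "Use" + "Assembly")

This file is the MATHEMATICS a `bz` / `bz_aut` branch of the certificate checker (qec PARTITION v2.1 ITEM 10.L5,
owner qec-type-10, `Census/CertCheckBZ.lean`) applies after its Boolean replay: every hypothesis below is a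
plain proposition over a CSS code `C : CSSCode RX RZ Q` (type-02's `Literature/…/QuantumCodes/CSS.lean`) that the
checker establishes from bitmask data, and every conclusion is about `C.dZ` / `C.dX`. Side `Z` throughout
(syndromes by `H^X`, stabilizers `rs H^Z`, logicals `L = LZ`, duals `Ld = LX`); side `X` = the same for `C.swap`.

Inputs it COMBINES (nothing here is re-proved from them):
* L5 — `Literature.InformationTheory.Coding.bz_enumeration_span` (`Coding/BrouwerZimmermannBound.lean`,
  qec-type-07): depth-`t_i` enumeration of systematic matrices + `wmax < bzBound` ⇒ every non-zero codeword of
  the block code of weight `≤ wmax` has the enumerated property (here: "is a `Z`-stabilizer");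
* L1 — the LOGICAL-BASIS DECOMPOSITION, taken as the HYPOTHESIS `hdec : ∀ z, H^X z = 0 → ∃ a, z − Σ aᵢ Lᵢ ∈ rs H^Z`
  (exactly the conclusion of type-10's `Census/CertLogical.lean`, `exists_coeffs_of_ker`) together with the pairing
  `Ld_j ⬝ L_i = [i = j]` (`dual_dotProduct_logVec`), `H^Z Ld_j = 0`, `H^X L_i = 0`;
* L6 — automorphism TRANSPORT, taken abstractly: maps `φ_a` sending non-trivial `Z`-logicals to non-trivial
  `Z`-logicals of the same weight and acting on labels by a matrix `ρ_a` (hypotheses `hφ`, `hρ`); for qubit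
  permutations `σ` with `H.submatrix ρ σ = H` the first part is type-12's `OrbitReduction.lean`
  (`CSSCode.zLogical_comp_equiv_symm`, instantiated in `bz_transport_perm`), the label action `ρ(σ)` is type-12's
  item (3) and enters here only as the hypothesis `hρ`;
* L7 — parity enters only as the hypothesis `∀ z, H^X z = 0 → Even |z|` (type-06's `Census/CertParity.lean`).

What is PROVED here (all side `Z`, no new definitions — the LABEL of `z` is written `Ld *ᵥ z`, i.e.
`(Ld *ᵥ z) j = Ld_j ⬝ z`):
* labels: `mulVec_eq_zero_of_mem_rowSpZ` (stabilizers have label `0`), `mulVec_sum_smul_eq` (`Ld (Σ aᵢ Lᵢ) = a`),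
  `sub_sum_mulVec_smul_mem_rowSpZ` (the coefficients in `hdec` ARE the labels), `mem_rowSpZ_iff_mulVec_eq_zero`,
  `mulVec_ne_zero_of_not_mem_rowSpZ` (a non-trivial logical has a non-zero label), `zLogical_of_pairing`
  (`L_i` is a non-trivial `Z`-logical — the existence guard of `CSSCode.le_dZ`), `mem_span_of_label_mem_span`
  (a logical whose label lies in `span W` lies in the block code `span Gb ⊇ rs H^Z ∪ {Σ_{i} w_i L_i : w ∈ W}`);
* `bz_block` — PER-BLOCK SOUNDNESS: block code `span Gb` as above, matrices `G_i` systematic on `T_i` with rows in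
  `span Gb`, enumeration verdict "every depth-`≤ t_i` combination of weight `≤ wmax` is in `rs H^Z`",
  `wmax < bzBound T t` ⇒ every non-trivial `Z`-logical whose label lies in `span W` has weight `> wmax`;
* `bz_cover` — COVER: per-block conclusions for label sets `S b`, transports `(φ_a, ρ_a)`, and
  "every non-zero label `λ` has `λ ∈ S b` or `ρ_a λ ∈ S b` for some listed `a`, `b`" ⇒ EVERY non-trivial
  `Z`-logical has weight `> wmax`; `bz_cover_of_blocks` (no transports, method `bz`); `bz_transport_perm`
  (the `hφ` hypothesis for a permutation automorphism, from type-12's transport lemma);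
* `lt_hammingNorm_of_even` — parity upgrade `wmax − wmax % 2 < |z|`, `|z|` even ⇒ `wmax < |z|`;
* distance: `succ_le_dZ_of_forall_lt` (`wmax + 1 ≤ d^Z`), `dZ_eq_succ_of_forall_lt` (with an upper witness,
  `d^Z = wmax + 1`), and the `X`-side twins via `C.swap`;
* packaged method `bz` with a uniform block shape: `forall_lt_of_bz`, `dZ_eq_of_bz`.

HONEST FRAMING: nothing here reads a certificate or trusts a producer; the Boolean replay (C1–C5 of
BZ-CHECKER-SPEC) and the bitmask ↔ `Fin n → ZMod 2` bridge are type-10's `CertCheckBZ.lean`, which discharges the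
hypotheses of `bz_block` / `bz_cover` literally. No distance VALUE is asserted in this file.
-/

namespace Summit.Ventures.QEC.Census

open Matrix Finset Module Literature.InformationTheory.QuantumCodes Literature.InformationTheory.Coding

variable {RX RZ Q : Type*} [Fintype RX] [Fintype RZ] [Fintype Q] [DecidableEq Q] {k : ℕ}

/-! ## Labels of `Z`-type operators with respect to a paired logical basis

Data (side `Z`): `L : Fin k → Q → ZMod 2` (the logicals `LZ`), `Ld : Matrix (Fin k) Q (ZMod 2)` (the duals `LX`,
row `j` = `LX_j`); the label of `z` is `Ld *ᵥ z = (LX_j ⬝ z)_j`. -/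

section Labels

variable (C : CSSCode RX RZ Q) {L : Fin k → Q → ZMod 2} {Ld : Matrix (Fin k) Q (ZMod 2)}

omit [Fintype RX] [DecidableEq Q] in
/-- The label is computed row by row: `(Ld *ᵥ z) j = Ld_j ⬝ z`. -/
theorem mulVec_apply_eq_dotProduct (Ld : Matrix (Fin k) Q (ZMod 2)) (z : Q → ZMod 2) (j : Fin k) :
    (Ld *ᵥ z) j = Ld j ⬝ᵥ z := rfl

omit [Fintype RX] [DecidableEq Q] in
/-- Stabilizers have label `0`: if every dual `Ld_j` lies in `ker H^Z` then `Ld *ᵥ s = 0` for `s ∈ rs H^Z`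
(CERT-FORMAT §4 L1, "label 0 ⇐ stabilizer"). -/
theorem mulVec_eq_zero_of_mem_rowSpZ (hdual : ∀ j, C.HZ *ᵥ Ld j = 0) {s : Q → ZMod 2} (hs : s ∈ C.rowSpZ) :
    Ld *ᵥ s = 0 := by
  funext j
  rw [mulVec_apply_eq_dotProduct, Pi.zero_apply]
  exact dotProduct_eq_zero_of_mem_rowSpace hs (hdual j)

omit [Fintype RX] [Fintype RZ] [DecidableEq Q] in
/-- The pairing reads off coefficients: `Ld *ᵥ (Σ_i a_i • L_i) = a` when `Ld_j ⬝ L_i = [i = j]`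
(CERT-FORMAT §4 L1, "the coefficient of `Lgen[i]` in `z` is `⟨Llab[i], z⟩`"). -/
theorem mulVec_sum_smul_eq (hpair : ∀ i j, Ld j ⬝ᵥ L i = if i = j then 1 else 0) (a : Fin k → ZMod 2) :
    Ld *ᵥ (∑ i, a i • L i) = a := by
  funext j
  rw [mulVec_apply_eq_dotProduct, dotProduct_sum]
  simp_rw [dotProduct_smul, hpair, smul_eq_mul]
  simp

omit [Fintype RX] [DecidableEq Q] in
/-- **The decomposition coefficients are the labels.** From L1's `∃ a, z − Σ aᵢ Lᵢ ∈ rs H^Z` (type-10's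
`exists_coeffs_of_ker`), the duals in `ker H^Z` and the pairing: `z − Σ_i (Ld *ᵥ z)_i • L_i ∈ rs H^Z`
(CERT-FORMAT §4 L1: `z = s ⊕ ⊕_{i : |LX_i ∩ z| odd} LZ_i`). -/
theorem sub_sum_mulVec_smul_mem_rowSpZ (hdual : ∀ j, C.HZ *ᵥ Ld j = 0)
    (hpair : ∀ i j, Ld j ⬝ᵥ L i = if i = j then 1 else 0)
    {z : Q → ZMod 2} (hdec : ∃ a : Fin k → ZMod 2, z - ∑ i, a i • L i ∈ C.rowSpZ) :
    z - ∑ i, (Ld *ᵥ z) i • L i ∈ C.rowSpZ := by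
  obtain ⟨a, ha⟩ := hdec
  have hlab : Ld *ᵥ (z - ∑ i, a i • L i) = 0 := mulVec_eq_zero_of_mem_rowSpZ C hdual ha
  rw [mulVec_sub, mulVec_sum_smul_eq hpair, sub_eq_zero] at hlab
  rw [hlab]
  exact ha

omit [Fintype RX] [DecidableEq Q] in
/-- **Label `0` ⇔ stabilizer** for `z ∈ ker H^X` (CERT-FORMAT §4 L1: "`z ∈ rowspace(HZ) ⇔ |LX_i ∩ z|` even
for all `i`"). -/
theorem mem_rowSpZ_iff_mulVec_eq_zero (hdual : ∀ j, C.HZ *ᵥ Ld j = 0)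
    (hpair : ∀ i j, Ld j ⬝ᵥ L i = if i = j then 1 else 0)
    {z : Q → ZMod 2} (hdec : ∃ a : Fin k → ZMod 2, z - ∑ i, a i • L i ∈ C.rowSpZ) :
    z ∈ C.rowSpZ ↔ Ld *ᵥ z = 0 := by
  refine ⟨mulVec_eq_zero_of_mem_rowSpZ C hdual, fun h0 => ?_⟩
  have h := sub_sum_mulVec_smul_mem_rowSpZ C hdual hpair hdec
  simpa [h0] using h

omit [Fintype RX] [DecidableEq Q] in
/-- A non-trivial `Z`-logical has a NON-ZERO label. -/
theorem mulVec_ne_zero_of_not_mem_rowSpZ (hdual : ∀ j, C.HZ *ᵥ Ld j = 0)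
    (hpair : ∀ i j, Ld j ⬝ᵥ L i = if i = j then 1 else 0)
    {z : Q → ZMod 2} (hdec : ∃ a : Fin k → ZMod 2, z - ∑ i, a i • L i ∈ C.rowSpZ) (hz' : z ∉ C.rowSpZ) :
    Ld *ᵥ z ≠ 0 :=
  fun h0 => hz' ((mem_rowSpZ_iff_mulVec_eq_zero C hdual hpair hdec).2 h0)

omit [Fintype RX] [DecidableEq Q] in
/-- Each listed logical `L_i` is a non-trivial `Z`-logical: `H^X L_i = 0` and `L_i ∉ rs H^Z`, the latter
witnessed by its dual (`H^Z Ld_i = 0`, `Ld_i ⬝ L_i = 1`; type-02's `not_mem_rowSpace_of_witness`). This is the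
existence guard of `CSSCode.le_dZ` (CERT-FORMAT O3/O4: `k ≥ 1`). -/
theorem zLogical_of_pairing (hsyn : ∀ i, C.HX *ᵥ L i = 0) (hdual : ∀ j, C.HZ *ᵥ Ld j = 0)
    (hpair : ∀ i j, Ld j ⬝ᵥ L i = if i = j then 1 else 0) (i : Fin k) :
    C.HX *ᵥ L i = 0 ∧ L i ∉ C.rowSpZ := by
  refine ⟨hsyn i, not_mem_rowSpace_of_witness (Ld i) (hdual i) ?_⟩
  rw [hpair i i, if_pos rfl]
  exact one_ne_zero

omit [Fintype RX] [DecidableEq Q] in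
/-- **A logical whose label lies in `span W` lies in the block code.** If `rs H^Z ≤ span Gb` and every
`Σ_i w_i • L_i` (`w` a listed label vector of the block) lies in `span Gb`, then every `z ∈ ker H^X` whose label
is in `span (range W)` lies in `span Gb` (BZ-CHECKER-SPEC §L L5 "Use": `C_b := span(G_b) ⊇ {z ∈ ker Hsyn :
label(z) ∈ span(W_basis_b)}`, with `G_b = Hstab pivot rows ++ W-combinations of Lgen`). -/
theorem mem_span_of_label_mem_span (hdual : ∀ j, C.HZ *ᵥ Ld j = 0)
    (hpair : ∀ i j, Ld j ⬝ᵥ L i = if i = j then 1 else 0)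
    {kb : ℕ} {Gb : Fin kb → Q → ZMod 2} (hrows : C.rowSpZ ≤ Submodule.span (ZMod 2) (Set.range Gb))
    {jW : ℕ} {W : Fin jW → Fin k → ZMod 2}
    (hW : ∀ l, ∑ i, W l i • L i ∈ Submodule.span (ZMod 2) (Set.range Gb))
    {z : Q → ZMod 2} (hdec : ∃ a : Fin k → ZMod 2, z - ∑ i, a i • L i ∈ C.rowSpZ)
    (hlab : Ld *ᵥ z ∈ Submodule.span (ZMod 2) (Set.range W)) :
    z ∈ Submodule.span (ZMod 2) (Set.range Gb) := by
  have hs := sub_sum_mulVec_smul_mem_rowSpZ C hdual hpair hdec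
  obtain ⟨b, hb⟩ := (Submodule.mem_span_range_iff_exists_fun (ZMod 2)).1 hlab
  have hsum : ∑ i, (Ld *ᵥ z) i • L i ∈ Submodule.span (ZMod 2) (Set.range Gb) := by
    have : ∑ i, (Ld *ᵥ z) i • L i = ∑ l, b l • ∑ i, W l i • L i := by
      rw [← hb]
      simp_rw [Finset.smul_sum, Finset.sum_apply, Pi.smul_apply, smul_eq_mul, Finset.sum_smul, mul_smul]
      rw [Finset.sum_comm]
    rw [this]
    exact Submodule.sum_mem _ fun l _ => Submodule.smul_mem _ _ (hW l)
  have := Submodule.add_mem _ (hrows hs) hsum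
  simpa using this

end Labels

/-! ## Per-block soundness (L5 applied to a block code) -/

section Block

variable (C : CSSCode RX RZ Q) {L : Fin k → Q → ZMod 2} {Ld : Matrix (Fin k) Q (ZMod 2)}

omit [Fintype RX] in
/-- **`bz` per-block soundness.** Block data: `Gb` (`kb` vectors: the `H^Z` pivot rows and the block's
`W`-combinations of the logicals, so `rs H^Z ≤ span Gb` and `Σ w_i L_i ∈ span Gb`), matrices `G_i = A_i · Gb`
(rows in `span Gb`) systematic on `T_i`, the ENUMERATION VERDICT "every `a ᵥ* G_i` with `1 ≤ |a| ≤ t_i` and weight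
`≤ wmax` lies in `rs H^Z`" (C4 with the allow-list C1), and `wmax < bzBound T t` (C3). Then every non-trivial
`Z`-logical whose label lies in `span (range W)` has weight `> wmax` (BZ-CHECKER-SPEC §L L5 "Use"). -/
theorem bz_block (hdual : ∀ j, C.HZ *ᵥ Ld j = 0) (hpair : ∀ i j, Ld j ⬝ᵥ L i = if i = j then 1 else 0)
    (hdec : ∀ z : Q → ZMod 2, C.HX *ᵥ z = 0 → ∃ a : Fin k → ZMod 2, z - ∑ i, a i • L i ∈ C.rowSpZ)
    {kb : ℕ} {Gb : Fin kb → Q → ZMod 2} (hrows : C.rowSpZ ≤ Submodule.span (ZMod 2) (Set.range Gb))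
    {jW : ℕ} {W : Fin jW → Fin k → ZMod 2}
    (hW : ∀ l, ∑ i, W l i • L i ∈ Submodule.span (ZMod 2) (Set.range Gb))
    {m : ℕ} {G : Fin m → Fin kb → Q → ZMod 2} {T : Fin m → Fin kb → Q}
    (hsys : ∀ i j j', G i j (T i j') = if j = j' then 1 else 0)
    (hG : ∀ i j, G i j ∈ Submodule.span (ZMod 2) (Set.range Gb))
    {t : Fin m → ℕ} {wmax : ℕ}
    (henum : ∀ i (a : Fin kb → ZMod 2), 1 ≤ hammingNorm a → hammingNorm a ≤ t i →
      hammingNorm (∑ j, a j • G i j) ≤ wmax → (∑ j, a j • G i j) ∈ C.rowSpZ)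
    (hbound : wmax < bzBound T t)
    {z : Q → ZMod 2} (hz : C.HX *ᵥ z = 0) (hz' : z ∉ C.rowSpZ)
    (hlab : Ld *ᵥ z ∈ Submodule.span (ZMod 2) (Set.range W)) : wmax < hammingNorm z := by
  have hzspan : z ∈ Submodule.span (ZMod 2) (Set.range Gb) :=
    mem_span_of_label_mem_span C hdual hpair hrows hW (hdec z hz) hlab
  have hz0 : z ≠ 0 := by
    rintro rfl
    exact hz' (Submodule.zero_mem _)
  by_contra hle
  rw [not_lt] at hle
  exact hz' (bz_enumeration_span (F := ZMod 2) (P := fun v => v ∈ C.rowSpZ) hsys hG henum hbound hzspan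
    hz0 hle)

end Block

/-! ## Cover: from per-block conclusions to every non-trivial logical -/

section Cover

variable (C : CSSCode RX RZ Q) {L : Fin k → Q → ZMod 2} {Ld : Matrix (Fin k) Q (ZMod 2)}

omit [Fintype RX] [DecidableEq Q] in
/-- **`bz` / `bz_aut` cover.** Suppose: for each block `b`, every non-trivial `Z`-logical with label in `S b`
has weight `> wmax` (`hblock`, from `bz_block`); the listed transports `φ_a` send non-trivial `Z`-logicals to
non-trivial `Z`-logicals of the same weight and act on labels by the matrices `ρ_a` (`hφ`; CERT-FORMAT L6); and
every NON-ZERO label `λ` is covered, `λ ∈ S b` or `ρ_a λ ∈ S b` for some listed `a`, `b` (C5). Then EVERY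
non-trivial `Z`-logical has weight `> wmax` (BZ-CHECKER-SPEC §L L6 "Use (cover)" / "Assembly"). No group
structure on the transports is used: each is applied once. -/
theorem bz_cover (hdual : ∀ j, C.HZ *ᵥ Ld j = 0) (hpair : ∀ i j, Ld j ⬝ᵥ L i = if i = j then 1 else 0)
    (hdec : ∀ z : Q → ZMod 2, C.HX *ᵥ z = 0 → ∃ a : Fin k → ZMod 2, z - ∑ i, a i • L i ∈ C.rowSpZ)
    {β : Type*} (S : β → Set (Fin k → ZMod 2)) {wmax : ℕ}
    (hblock : ∀ b (z : Q → ZMod 2), C.HX *ᵥ z = 0 → z ∉ C.rowSpZ → Ld *ᵥ z ∈ S b → wmax < hammingNorm z)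
    {α : Type*} (φ : α → (Q → ZMod 2) → (Q → ZMod 2)) (ρ : α → Matrix (Fin k) (Fin k) (ZMod 2))
    (hφ : ∀ a (z : Q → ZMod 2), C.HX *ᵥ z = 0 → z ∉ C.rowSpZ →
      C.HX *ᵥ φ a z = 0 ∧ φ a z ∉ C.rowSpZ ∧ hammingNorm (φ a z) = hammingNorm z ∧
        Ld *ᵥ φ a z = ρ a *ᵥ (Ld *ᵥ z))
    (hcover : ∀ lam : Fin k → ZMod 2, lam ≠ 0 → (∃ b, lam ∈ S b) ∨ (∃ a b, ρ a *ᵥ lam ∈ S b))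
    {z : Q → ZMod 2} (hz : C.HX *ᵥ z = 0) (hz' : z ∉ C.rowSpZ) : wmax < hammingNorm z := by
  have hne : Ld *ᵥ z ≠ 0 := mulVec_ne_zero_of_not_mem_rowSpZ C hdual hpair (hdec z hz) hz'
  rcases hcover _ hne with ⟨b, hb⟩ | ⟨a, b, hab⟩
  · exact hblock b z hz hz' hb
  · obtain ⟨h1, h2, h3, h4⟩ := hφ a z hz hz'
    rw [← h3]
    exact hblock b (φ a z) h1 h2 (h4 ▸ hab)

omit [Fintype RX] [DecidableEq Q] in
/-- **`bz` cover without transports** (method `bz`, C5: the blocks' spans cover every non-zero label). -/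
theorem bz_cover_of_blocks (hdual : ∀ j, C.HZ *ᵥ Ld j = 0)
    (hpair : ∀ i j, Ld j ⬝ᵥ L i = if i = j then 1 else 0)
    (hdec : ∀ z : Q → ZMod 2, C.HX *ᵥ z = 0 → ∃ a : Fin k → ZMod 2, z - ∑ i, a i • L i ∈ C.rowSpZ)
    {β : Type*} (S : β → Set (Fin k → ZMod 2)) {wmax : ℕ}
    (hblock : ∀ b (z : Q → ZMod 2), C.HX *ᵥ z = 0 → z ∉ C.rowSpZ → Ld *ᵥ z ∈ S b → wmax < hammingNorm z)
    (hcover : ∀ lam : Fin k → ZMod 2, lam ≠ 0 → ∃ b, lam ∈ S b)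
    {z : Q → ZMod 2} (hz : C.HX *ᵥ z = 0) (hz' : z ∉ C.rowSpZ) : wmax < hammingNorm z :=
  bz_cover C hdual hpair hdec S hblock (α := Empty) (fun a => a.elim) (fun a => a.elim)
    (fun a => a.elim) (fun lam hlam => Or.inl (hcover lam hlam)) hz hz'

omit [DecidableEq Q] in
/-- **Transport by a permutation automorphism** (the `hφ` data of `bz_cover` for `φ_σ z := z ∘ σ⁻¹`, minus the
label action): if `σ` permutes the qubits with `H^X.submatrix ρX σ = H^X` and `H^Z.submatrix ρZ σ = H^Z`
(C5: `perm` maps `HX` rows to `HX` rows and `HZ` rows to `HZ` rows), then `z ∘ σ⁻¹` is a non-trivial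
`Z`-logical of the same weight whenever `z` is (type-12's `CSSCode.zLogical_comp_equiv_symm` +
`hammingNorm_comp_equiv`; CERT-FORMAT §4 L6, first half). The label identity `Ld *ᵥ (z ∘ σ⁻¹) = ρ(σ) *ᵥ (Ld *ᵥ z)`
is type-12's item (3) and is supplied to `bz_cover` separately. -/
theorem bz_transport_perm {σ : Q ≃ Q} (hX : ∃ ρ : RX ≃ RX, C.HX.submatrix ρ σ = C.HX)
    (hZ : ∃ ρ : RZ ≃ RZ, C.HZ.submatrix ρ σ = C.HZ) {z : Q → ZMod 2} (hz : C.HX *ᵥ z = 0)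
    (hz' : z ∉ C.rowSpZ) :
    C.HX *ᵥ (z ∘ σ.symm) = 0 ∧ z ∘ σ.symm ∉ C.rowSpZ ∧ hammingNorm (z ∘ σ.symm) = hammingNorm z := by
  obtain ⟨h1, h2⟩ := C.zLogical_comp_equiv_symm hX hZ ⟨hz, hz'⟩
  exact ⟨h1, h2, hammingNorm_comp_equiv z σ⟩

end Cover

/-! ## Parity upgrade and the distance statements -/

section Distance

variable (C : CSSCode RX RZ Q)

/-- Arithmetic of the parity trick: an even `w` above `wmax − wmax % 2` is above `wmax`. -/
private theorem lt_of_even_of_sub_mod_two_lt' {wmax w : ℕ} (hw : Even w) (h : wmax - wmax % 2 < w) :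
    wmax < w := by
  rcases Nat.even_or_odd wmax with he | ho
  · rw [Nat.even_iff.1 he, Nat.sub_zero] at h; exact h
  · rw [Nat.odd_iff.1 ho] at h
    rcases hw with ⟨a, rfl⟩
    rcases ho with ⟨b, rfl⟩
    omega

omit [Fintype RX] [Fintype RZ] [DecidableEq Q] in
/-- **Parity upgrade** (CERT-FORMAT L7, second half): if every `z ∈ ker H^X` has even weight (type-06's
`CertParity.lean` from an `even_witness`) and the blocks were certified with the weakened threshold
`wmax_eff = wmax − wmax % 2`, the conclusion holds for `wmax`. -/
theorem lt_hammingNorm_of_even (heven : ∀ z : Q → ZMod 2, C.HX *ᵥ z = 0 → Even (hammingNorm z)) {wmax : ℕ}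
    {z : Q → ZMod 2} (hz : C.HX *ᵥ z = 0) (h : wmax - wmax % 2 < hammingNorm z) : wmax < hammingNorm z :=
  lt_of_even_of_sub_mod_two_lt' (heven z hz) h

omit [Fintype RX] [DecidableEq Q] in
/-- **Lower bound.** If some non-trivial `Z`-logical exists (e.g. `zLogical_of_pairing`) and every non-trivial
`Z`-logical has weight `> wmax` (`bz_cover`), then `wmax + 1 ≤ d^Z` (type-02's `CSSCode.le_dZ`). -/
theorem succ_le_dZ_of_forall_lt (hex : ∃ v : Q → ZMod 2, C.HX *ᵥ v = 0 ∧ v ∉ C.rowSpZ) {wmax : ℕ}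
    (hall : ∀ z : Q → ZMod 2, C.HX *ᵥ z = 0 → z ∉ C.rowSpZ → wmax < hammingNorm z) : wmax + 1 ≤ C.dZ :=
  C.le_dZ hex fun v hv hv' => Nat.succ_le_of_lt (hall v hv hv')

omit [Fintype RX] [DecidableEq Q] in
/-- **Exact distance** from an upper witness of weight `wmax + 1` and the `bz` lower bound (type-02's
`CSSCode.dZ_eq_of_witness`; CERT-FORMAT O5 + O6: `dZ = d` with `wmax = d − 1`). -/
theorem dZ_eq_succ_of_forall_lt {wmax : ℕ} {v : Q → ZMod 2} (hv : C.HX *ᵥ v = 0) (hv' : v ∉ C.rowSpZ)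
    (hwt : hammingNorm v = wmax + 1)
    (hall : ∀ z : Q → ZMod 2, C.HX *ᵥ z = 0 → z ∉ C.rowSpZ → wmax < hammingNorm z) : C.dZ = wmax + 1 :=
  C.dZ_eq_of_witness hv hv' hwt fun w hw hw' => Nat.succ_le_of_lt (hall w hw hw')

omit [Fintype RZ] [DecidableEq Q] in
/-- `X`-side lower bound: the `Z`-side statement for `C.swap` (`C.swap.HX = C.HZ`, `C.swap.rowSpZ = C.rowSpX`,
`C.swap.dZ = C.dX`). -/
theorem succ_le_dX_of_forall_lt (hex : ∃ v : Q → ZMod 2, C.HZ *ᵥ v = 0 ∧ v ∉ C.rowSpX) {wmax : ℕ}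
    (hall : ∀ z : Q → ZMod 2, C.HZ *ᵥ z = 0 → z ∉ C.rowSpX → wmax < hammingNorm z) : wmax + 1 ≤ C.dX :=
  C.le_dX hex fun v hv hv' => Nat.succ_le_of_lt (hall v hv hv')

omit [Fintype RZ] [DecidableEq Q] in
/-- `X`-side exact distance from an upper witness and the `bz` lower bound. -/
theorem dX_eq_succ_of_forall_lt {wmax : ℕ} {v : Q → ZMod 2} (hv : C.HZ *ᵥ v = 0) (hv' : v ∉ C.rowSpX)
    (hwt : hammingNorm v = wmax + 1)
    (hall : ∀ z : Q → ZMod 2, C.HZ *ᵥ z = 0 → z ∉ C.rowSpX → wmax < hammingNorm z) : C.dX = wmax + 1 :=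
  C.dX_eq_of_witness hv hv' hwt fun w hw hw' => Nat.succ_le_of_lt (hall w hw hw')

end Distance

/-! ## Packaged form for method `bz` (uniform block shape, as in CERT-FORMAT §5.3: `j`, `kb` fixed per side) -/

section Packaged

variable (C : CSSCode RX RZ Q) {L : Fin k → Q → ZMod 2} {Ld : Matrix (Fin k) Q (ZMod 2)}

omit [Fintype RX] in
/-- **Method `bz`, end to end (lower half of `sideOK`).** Blocks `b < nb`, each with its block code `span (Gb b)`
(containing `rs H^Z` and the block's `W b`-combinations of the logicals), `m` systematic matrices `G b i` on pivots
`T b i` with rows in `span (Gb b)`, depths `t b i`, the enumeration verdict, the bound `wmax < bzBound (T b) (t b)`,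
and the label cover `∀ λ ≠ 0, ∃ b, λ ∈ span (W b)` ⇒ every non-trivial `Z`-logical has weight `> wmax`.
(Blocks with different numbers of matrices: use `bz_block` per block and `bz_cover_of_blocks`; this packaged
form fixes one shape `m` for all blocks.) -/
theorem forall_lt_of_bz (hdual : ∀ j, C.HZ *ᵥ Ld j = 0) (hpair : ∀ i j, Ld j ⬝ᵥ L i = if i = j then 1 else 0)
    (hdec : ∀ z : Q → ZMod 2, C.HX *ᵥ z = 0 → ∃ a : Fin k → ZMod 2, z - ∑ i, a i • L i ∈ C.rowSpZ)
    {nb kb jW m : ℕ} {Gb : Fin nb → Fin kb → Q → ZMod 2}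
    (hrows : ∀ b, C.rowSpZ ≤ Submodule.span (ZMod 2) (Set.range (Gb b)))
    {W : Fin nb → Fin jW → Fin k → ZMod 2}
    (hW : ∀ b l, ∑ i, W b l i • L i ∈ Submodule.span (ZMod 2) (Set.range (Gb b)))
    {G : Fin nb → Fin m → Fin kb → Q → ZMod 2} {T : Fin nb → Fin m → Fin kb → Q}
    (hsys : ∀ b i j j', G b i j (T b i j') = if j = j' then 1 else 0)
    (hG : ∀ b i j, G b i j ∈ Submodule.span (ZMod 2) (Set.range (Gb b)))
    {t : Fin nb → Fin m → ℕ} {wmax : ℕ}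
    (henum : ∀ b i (a : Fin kb → ZMod 2), 1 ≤ hammingNorm a → hammingNorm a ≤ t b i →
      hammingNorm (∑ j, a j • G b i j) ≤ wmax → (∑ j, a j • G b i j) ∈ C.rowSpZ)
    (hbound : ∀ b, wmax < bzBound (T b) (t b))
    (hcover : ∀ lam : Fin k → ZMod 2, lam ≠ 0 → ∃ b, lam ∈ Submodule.span (ZMod 2) (Set.range (W b)))
    {z : Q → ZMod 2} (hz : C.HX *ᵥ z = 0) (hz' : z ∉ C.rowSpZ) : wmax < hammingNorm z :=
  bz_cover_of_blocks C hdual hpair hdec (fun b => (Submodule.span (ZMod 2) (Set.range (W b)) : Set _))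
    (fun b _ hw hw' hlab => bz_block C hdual hpair hdec (hrows b) (hW b) (hsys b) (hG b) (henum b) (hbound b)
      hw hw' hlab) hcover hz hz'

omit [Fintype RX] in
/-- **Method `bz`, the distance** (`dZ = wmax + 1`): `forall_lt_of_bz` + an upper witness of weight `wmax + 1`
(CERT-FORMAT O5 + O6(c): `wmax = d − 1`). The existence guard is automatic from the witness. -/
theorem dZ_eq_of_bz (hdual : ∀ j, C.HZ *ᵥ Ld j = 0) (hpair : ∀ i j, Ld j ⬝ᵥ L i = if i = j then 1 else 0)
    (hdec : ∀ z : Q → ZMod 2, C.HX *ᵥ z = 0 → ∃ a : Fin k → ZMod 2, z - ∑ i, a i • L i ∈ C.rowSpZ)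
    {nb kb jW m : ℕ} {Gb : Fin nb → Fin kb → Q → ZMod 2}
    (hrows : ∀ b, C.rowSpZ ≤ Submodule.span (ZMod 2) (Set.range (Gb b)))
    {W : Fin nb → Fin jW → Fin k → ZMod 2}
    (hW : ∀ b l, ∑ i, W b l i • L i ∈ Submodule.span (ZMod 2) (Set.range (Gb b)))
    {G : Fin nb → Fin m → Fin kb → Q → ZMod 2} {T : Fin nb → Fin m → Fin kb → Q}
    (hsys : ∀ b i j j', G b i j (T b i j') = if j = j' then 1 else 0)
    (hG : ∀ b i j, G b i j ∈ Submodule.span (ZMod 2) (Set.range (Gb b)))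
    {t : Fin nb → Fin m → ℕ} {wmax : ℕ}
    (henum : ∀ b i (a : Fin kb → ZMod 2), 1 ≤ hammingNorm a → hammingNorm a ≤ t b i →
      hammingNorm (∑ j, a j • G b i j) ≤ wmax → (∑ j, a j • G b i j) ∈ C.rowSpZ)
    (hbound : ∀ b, wmax < bzBound (T b) (t b))
    (hcover : ∀ lam : Fin k → ZMod 2, lam ≠ 0 → ∃ b, lam ∈ Submodule.span (ZMod 2) (Set.range (W b)))
    {v : Q → ZMod 2} (hv : C.HX *ᵥ v = 0) (hv' : v ∉ C.rowSpZ) (hwt : hammingNorm v = wmax + 1) :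
    C.dZ = wmax + 1 :=
  dZ_eq_succ_of_forall_lt C hv hv' hwt fun _ hw hw' =>
    forall_lt_of_bz C hdual hpair hdec hrows hW hsys hG henum hbound hcover hw hw'

end Packaged

end Summit.Ventures.QEC.Census
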